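import Summits.HubbardSuperconductivity.HubbardSuperconductivity.Theorems.AnisotropyChordTransferFibre3FinXDCheck

/-!
# Route `AnisotropyChord` / H0 rotor rung: FIN per-`L` row-D (KT-2a″) SUB-CELL facts, `L = 9` (6–11)

Row-D facts `xdCellAny0 9 (49/50) la lb aD = true` on quarter sub-cells of the combined cells whose side condition needs `aD ≈ .04` (mechhunt STATUS p3 g7 REPORT 3).
Prover seat `hubbard-h0-rotor-p3` g7; helper for piece A = stmt-HubbardSuperconductivity-23918 of rung 19089 (`--supports`, helper class).
WHAT THIS IS NOT: nothing here proves superconductivity in the Hubbard model (rotor TARGET as worded stays FALSE, g15 verdict); kernel facts /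
assembly for ONE conditional reduction at one `L`.  No sorry.
-/

set_option linter.dupNamespace false
set_option autoImplicit false

namespace Summit.HubbardSuperconductivity.HubbardSuperconductivity.Theorems.AnisotropyChord.Transfer.Fibre3

namespace FinXD

/-- row-D sub-cell `[10624669485396740, 10690253864936226]` of `L = 9`. [folklore] -/
theorem xd9s_110_2 : xdCellAny0 9 (49/50 : ℚ) 10624669485396740 10690253864936226 (1/25 : ℚ) = true := by decide +kernel

/-- row-D sub-cell `[10690253864936226, 10755838244475713]` of `L = 9`. [folklore] -/
theorem xd9s_110_3 : xdCellAny0 9 (49/50 : ℚ) 10690253864936226 10755838244475713 (1/25 : ℚ) = true := by decide +kernel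

/-- row-D sub-cell `[10755838244475713, 10823062233503686]` of `L = 9`. [folklore] -/
theorem xd9s_111_0 : xdCellAny0 9 (49/50 : ℚ) 10755838244475713 10823062233503686 (1/25 : ℚ) = true := by decide +kernel

/-- row-D sub-cell `[10823062233503686, 10890286222531659]` of `L = 9`. [folklore] -/
theorem xd9s_111_1 : xdCellAny0 9 (49/50 : ℚ) 10823062233503686 10890286222531659 (1/25 : ℚ) = true := by decide +kernel

/-- row-D sub-cell `[10890286222531659, 10957510211559632]` of `L = 9`. [folklore] -/
theorem xd9s_111_2 : xdCellAny0 9 (49/50 : ℚ) 10890286222531659 10957510211559632 (1/25 : ℚ) = true := by decide +kernel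

/-- row-D sub-cell `[10957510211559632, 11024734200587605]` of `L = 9`. [folklore] -/
theorem xd9s_111_3 : xdCellAny0 9 (49/50 : ℚ) 10957510211559632 11024734200587605 (1/25 : ℚ) = true := by decide +kernel

end FinXD

end Summit.HubbardSuperconductivity.HubbardSuperconductivity.Theorems.AnisotropyChord.Transfer.Fibre3
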